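/-
Copyright: the b2b-balaban cell (near-miss cell 7), T⁴-continuum fan-out; row NE7b ROUND-2 swarm, seat
t4-ne7b-formalise-leaf-10 (gen 3; sub-row S6g′(f) of `t4/b2b-balaban-t4-ne7b-p1/LEAVES-NE7b.md`, owner's rulings
R-OWNER-22-12 (2), 22-18, 22-19).  Released under the licence of the surrounding project.
-/
import Summits.QuantumFields.BalabanUV.T4Continuum.Support.HistorySiblingEntropySorted

/-!
# Sibling entropy bound, the RENEWAL-CHARGING bridge: renewals RECORDED in the shape (as one-part joins on a doubled
# clock) and paid `8` each — the order display no longer asks renewal patterns to be canonical (row S6g′(f))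

Summits-side support leaf of the T⁴-continuum cell (rung (B)+1 on a FINITE torus only; NOT infinite volume, NOT the
mass gap, NOT the Clay statement; NOT a proof of the spine estimate NE7b).  Row NE7b, route «COUNT», row S6g′
«MASS-BASED SIBLING COUNT»; sequel of `HistorySiblingEntropySorted`.  [folklore] well-founded recursion over the
lineage's own carrier and finite sums; nothing is quoted from print, nothing printed is asserted, no `[cite:]` tag, no
`Prop` fact minted.

WHY.  `toShapeS` (the sorted bridge) is TRANSPARENT at renewals, so its one display `InjPartsS` silently asks that
sibling parts with equal sorted shapes carry EQUAL RENEWAL PATTERNS — but whether an old ready component is renewed at a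
step is geometric (a fresh large field inside it), not a function of the shape; on members with renewal-variant
siblings `InjPartsS` fails and the binding's `ENT` (classes = equal sub-genealogies, renewals included) is genuinely
larger than the shape entropy.  **`toShapeR`** RECORDS every renewal in the shape — as a join of the line with ONE
dummy part `atom (2·st e) 0` at the odd half-step `2·st e + 1` of a DOUBLED clock (births at `2j`, mergers at
`2·st e + 2`; the doubling keeps the chronology strict when a part is renewed AT the step of the join it enters) — so
renewal patterns are now PART OF THE SHAPE: the display **`InjPartsR`** asks only «equal recorded shapes ⇒ equal
sub-genealogies», i.e. canonical ORDER and LABELS (row S1c's sorted listing; flat labels `(step, kind, d′)`), nothing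
about renewals.  The price: `Φ(toShapeR G) ≤ bsum (1 + fat) G + 2·AG G + 4·NR G` (ages double; `4` per renewal), so
the END pays **`8·NR`** (`NR` = the number of renewal nodes, by name) and `4·partnerAges + 8·mrg` instead of `2· + 4·`.

WHAT.  `toShapeR`, `InjPartsR`, `NR`; `toShapeR_root` (`= 2·rootStep`), `wf_toShapeR` (⇐ `Mono`), `canon_toShapeR`
(unconditional), `phi_toShapeR_le`, `ent_toShapeR` (⇐ `InjPartsR`), ENDs **`E_leR`**, **`ENT_leR`**:
`Mono st G → InjPartsR st fat G → ENT st G ≤ 2·bsum (1 + fat) G + 4·partnerAges st G + 8·mrg st G + 8·NR st G`, and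
**`ENT_leR_genT`** on pedigrees (`HeadOldest` + `InjPartsR`).

HONEST SCOPE.  `InjPartsR` displayed (order∕labels: row S1c); the renewal count `NR` enters the budget BY NAME and is
NOT shown class-linear here (it is bounded by the history's renewal events, a datum of the class bookkeeping, not of
this file).  Nothing of H3∕(B)∕BetaPertH touched.  NE7b NOT proved.  HONEST DEPENDENCY (cell): continuum YM on T⁴ ⇐
BetaPertH ∧ nine spine estimates (0/9 proved); BetaPertH ⇐ (D1) ∧ (D4) ∧ CAP+tail; G-an2-4 gates asym, D1 and
NE2/3/4.  This file changes none of it.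
-/

open Finset
open Literature.MathematicalPhysics.QuantumFieldTheory.Balaban1983to89
open T4PersistenceDictionary T4PartnerMultiplicity T4BranchingRecordsGas
open Summit.QuantumFields.BalabanUV.T4Continuum.HistoryJoins
open Summit.QuantumFields.BalabanUV.T4Continuum.HistoryJoinsAdm
open Summit.QuantumFields.BalabanUV.T4Continuum.HistoryJoinsClass
open Summit.QuantumFields.BalabanUV.T4Continuum.HistorySiblingEntropy
open Summit.QuantumFields.BalabanUV.T4Continuum.HistorySiblingEntropyBound
open Summit.QuantumFields.BalabanUV.T4Continuum.HistoryJoinsBudget (mrg)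
open Summit.QuantumFields.BalabanUV.T4Continuum.HistoryJoinsEntropyBudget (ent ENT)

namespace Summit.QuantumFields.BalabanUV.T4Continuum.HistorySiblingEntropyBridge

noncomputable section

open scoped Classical

variable {ε : Type*} (st : ε → ℕ) (fat : ε → ℕ)

/-! ## §1 The renewal-recording shape, its display, the renewal count -/

/-- **THE RENEWAL-RECORDING SHAPE** on the doubled clock: births `atom (2j) (fat b)`; a renewal = a join at
`2·st e + 1` of the line with one dummy part `atom (2·st e) 0`; a merger = a join at `2·st e + 2`, non-host shapes
SORTED. [folklore] -/
def toShapeR : Gen ε → Shape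
  | Gen.born b j => .atom (2 * j) (fat b)
  | Gen.renew G e _ => .join (2 * st e + 1) (toShapeR G) (ofList [.atom (2 * st e) 0])
  | Gen.merge X Y e =>
      .join (2 * st e + 2) (toShapeR (part st (Gen.merge X Y e) (hostIdx st X Y e)).2)
        (ofList (sortS ((nonhost st X Y e).map fun i => toShapeR (part st (Gen.merge X Y e) i).2)))
termination_by G => gsize G
decreasing_by
  all_goals first
    | (simp only [gsize]; omega)
    | exact gsize_lt_of_mem_jparts st _ _ (part_mem st _ _)

/-- unfolding at a birth [folklore] -/
@[simp] theorem toShapeR_born (b : ε) (j : ℕ) : toShapeR st fat (Gen.born b j) = .atom (2 * j) (fat b) := by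
  rw [toShapeR]
/-- unfolding at a renewal [folklore] -/
theorem toShapeR_renew (G : Gen ε) (e : ε) (h : ℕ) :
    toShapeR st fat (Gen.renew G e h) = .join (2 * st e + 1) (toShapeR st fat G) (ofList [.atom (2 * st e) 0]) := by
  rw [toShapeR]

/-- unfolding at a merger [folklore] -/
theorem toShapeR_merge (X Y : Gen ε) (e : ε) :
    toShapeR st fat (Gen.merge X Y e) =
      .join (2 * st e + 2) (toShapeR st fat (part st (Gen.merge X Y e) (hostIdx st X Y e)).2)
        (ofList (sortS ((nonhost st X Y e).map fun i => toShapeR st fat (part st (Gen.merge X Y e) i).2))) := by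
  rw [toShapeR]

/-- **THE ORDER∕LABEL DISPLAY**: at every join, non-host parts with equal RECORDED shapes are equal sub-structures.
[folklore] -/
def InjPartsR : Gen ε → Prop
  | Gen.born _ _ => True
  | Gen.renew G _ _ => InjPartsR G
  | Gen.merge X Y e => (∀ i, InjPartsR (part st (Gen.merge X Y e) i).2) ∧
      ∀ i j, i ≠ hostIdx st X Y e → j ≠ hostIdx st X Y e →
        toShapeR st fat (part st (Gen.merge X Y e) i).2 = toShapeR st fat (part st (Gen.merge X Y e) j).2 →
          (part st (Gen.merge X Y e) i).2 = (part st (Gen.merge X Y e) j).2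
termination_by G => gsize G
decreasing_by
  all_goals first
    | (simp only [gsize]; omega)
    | exact gsize_lt_of_mem_jparts st _ _ (part_mem st _ _)

/-- **THE NUMBER OF RENEWAL NODES** (read through the joins' part lists, like `NH`). [folklore] -/
def NR : Gen ε → ℕ
  | Gen.born _ _ => 0
  | Gen.renew G _ _ => NR G + 1
  | Gen.merge X Y e => ∑ i, NR (part st (Gen.merge X Y e) i).2
termination_by G => gsize G
decreasing_by
  all_goals first
    | (simp only [gsize]; omega)
    | exact gsize_lt_of_mem_jparts st _ _ (part_mem st _ _)

/-! ## §2 The bridge lemmas -/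
/-- the root is twice the root step [folklore] -/
theorem toShapeR_root : ∀ G : Gen ε, (toShapeR st fat G).root = 2 * G.rootStep
  | Gen.born b j => by simp [Shape.root]
  | Gen.renew G e h => by rw [toShapeR_renew, Shape.root, toShapeR_root G]; rfl
  | Gen.merge X Y e => by
      rw [toShapeR_merge, Shape.root, toShapeR_root (part st (Gen.merge X Y e) (hostIdx st X Y e)).2,
        ← rootStep_eq_host]
termination_by G => gsize G
decreasing_by
  all_goals first
    | (simp only [gsize]; omega)
    | exact gsize_lt_of_mem_jparts st _ _ (part_mem st _ _)

/-- the last event of the recorded shape on the doubled clock [folklore] -/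
theorem lastR_le : ∀ G : Gen ε,
    (toShapeR st fat G).last ≤ 2 * top st G + (match G with | Gen.born _ _ => 0 | Gen.renew _ _ _ => 1 | _ => 2)
  | Gen.born b j => by simp [Shape.last, top]
  | Gen.renew G e h => by rw [toShapeR_renew]; simp [Shape.last, top]
  | Gen.merge X Y e => by rw [toShapeR_merge]; simp [Shape.last, top]

/-- a part of the top join of a `Mono` merger has its recorded shape's last event at most `2·st e + 1` [folklore] -/
theorem lastR_part_le {X Y : Gen ε} {e : ε} (hm : Mono st (Gen.merge X Y e)) (i : Fin (npart st (Gen.merge X Y e))) :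
    (toShapeR st fat (part st (Gen.merge X Y e) i).2).last ≤ 2 * st e + 1 := by
  have hq : part st (Gen.merge X Y e) i ∈ clusterParts st (st e) (Gen.merge X Y e) := part_mem st _ i
  have htq := top_le_of_mem_clusterParts st (st e) _ hm (by simp [top]) _ hq
  have hl := lastR_le st fat (part st (Gen.merge X Y e) i).2
  generalize hq2 : (part st (Gen.merge X Y e) i).2 = q at htq hl hq
  cases q with
  | born b j => simp only [top] at htq hl; omega
  | renew G e' h => simp only [top] at htq hl; omega
  | merge X' Y' e' =>
      have hne := st_ne_of_mem_clusterParts st (st e) _ _ hq X' Y' e' hq2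
      simp only [top] at htq hl
      omega

/-- **WELL-FORMEDNESS OF THE RECORDED SHAPE** from the displayed chronology. [folklore] -/
theorem wf_toShapeR : ∀ G : Gen ε, Mono st G → (toShapeR st fat G).WF
  | Gen.born b j, _ => by simp [Shape.WF]
  | Gen.renew G e h, hm => by
      rw [toShapeR_renew]
      simp only [Mono] at hm
      have hl := lastR_le st fat G
      have h2 : (match (G : Gen ε) with | Gen.born _ _ => 0 | Gen.renew _ _ _ => 1 | _ => 2) ≤ 2 := by
        cases G <;> simp
      refine ⟨wf_toShapeR G hm.1, by omega, by simp [ofList], ?_⟩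
      rw [Parts.wf_iff, toList_ofList]
      intro x hx
      rw [List.mem_singleton.1 hx]
      exact ⟨trivial, by simp [Shape.last]⟩
  | Gen.merge X Y e, hm => by
      rw [toShapeR_merge]
      have hparts : ∀ i, (toShapeR st fat (part st (Gen.merge X Y e) i).2).WF := fun i =>
        wf_toShapeR (part st (Gen.merge X Y e) i).2 (mono_of_mem_clusterParts st (st e) _ hm _ (part_mem st _ i))
      refine ⟨hparts _, by have := lastR_part_le st fat hm (hostIdx st X Y e); omega, ?_, ?_⟩
      · have hn2 : 2 ≤ npart st (Gen.merge X Y e) := by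
          have h1 := one_le_length_clusterParts st (st e) X
          have h2 := one_le_length_clusterParts st (st e) Y
          have : (jparts st (Gen.merge X Y e)).length =
              (clusterParts st (st e) X).length + (clusterParts st (st e) Y).length := by
            rw [jparts_merge, List.length_append, List.length_map, List.length_map]
          simp only [npart]; omega
        intro h0
        have hlen := congrArg (fun ps => ps.toList.length) h0
        simp only [toList_ofList, Parts.toList, List.length_nil] at hlen
        rw [(sortS_perm _).length_eq, List.length_map] at hlen
        obtain ⟨i, hi⟩ : ∃ i : Fin (npart st (Gen.merge X Y e)), i ≠ hostIdx st X Y e :=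
          Fintype.exists_ne_of_one_lt_card (by simp; omega) _
        have : i ∈ nonhost st X Y e := (mem_nonhost st).2 hi
        rw [List.length_eq_zero_iff.1 hlen] at this
        simp at this
      · rw [Parts.wf_iff, toList_ofList]
        intro x hx
        obtain ⟨i, _, rfl⟩ := List.mem_map.1 (mem_sortS.1 hx)
        exact ⟨hparts i, by have := lastR_part_le st fat hm i; omega⟩
termination_by G => gsize G
decreasing_by
  all_goals first
    | (simp only [gsize]; omega)
    | exact gsize_lt_of_mem_jparts st _ _ (part_mem st _ _)

/-- **CANONICITY OF THE RECORDED SHAPE — UNCONDITIONAL.** [folklore] -/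
theorem canon_toShapeR : ∀ G : Gen ε, (toShapeR st fat G).Canon
  | Gen.born b j => by simp [Shape.Canon]
  | Gen.renew G e h => by
      rw [toShapeR_renew]
      refine ⟨canon_toShapeR G, ?_, by rw [toList_ofList]; exact List.pairwise_singleton _ _⟩
      rw [Parts.canon_iff, toList_ofList]
      intro x hx
      rw [List.mem_singleton.1 hx]
      simp [Shape.Canon]
  | Gen.merge X Y e => by
      rw [toShapeR_merge]
      refine ⟨canon_toShapeR _, ?_, by rw [toList_ofList]; exact sortS_pairwise _⟩
      rw [Parts.canon_iff, toList_ofList]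
      intro x hx
      obtain ⟨i, _, rfl⟩ := List.mem_map.1 (mem_sortS.1 hx)
      exact canon_toShapeR _
termination_by G => gsize G
decreasing_by
  all_goals first
    | (simp only [gsize]; omega)
    | exact gsize_lt_of_mem_jparts st _ _ (part_mem st _ _)

/-- the doubled age is at most twice the age (with the `ℕ`-truncations) [folklore] -/
theorem doubled_age_le (s r : ℕ) : (2 * s + 2 + 1 - 2 * r) + 1 ≤ 2 * ((s + 1 + 1 - r) + 1) := by omega

/-- **THE BUDGET OF THE RECORDED SHAPE**: `Φ(toShapeR G) ≤ bsum (1 + fat) G + 2·AG G + 4·NR G`. [folklore] -/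
theorem phi_toShapeR_le : ∀ G : Gen ε,
    ((toShapeR st fat G).phi : ℝ) ≤ bsum (fun b => (1 : ℝ) + fat b) G + 2 * (AG st G : ℝ) + 4 * (NR st G : ℝ)
  | Gen.born b j => by rw [toShapeR_born, AG, NR]; simp [Shape.phi, bsum]
  | Gen.renew G e h => by
      rw [toShapeR_renew, AG, NR]
      have ih := phi_toShapeR_le G
      simp only [Shape.phi, Parts.phi, ofList, Shape.root, Nat.cast_add, Nat.cast_one, bsum] at ih ⊢
      have : ((2 * st e + 1 + 1 - 2 * st e : ℕ) : ℝ) = 2 := by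
        rw [show 2 * st e + 1 + 1 - 2 * st e = 2 by omega]; norm_num
      rw [this]
      push_cast
      linarith
  | Gen.merge X Y e => by
      rw [toShapeR_merge, AG, NR]
      simp only [Shape.phi, Nat.cast_add, Nat.cast_sum]
      rw [Parts.phi_cast, toList_ofList, ((sortS_perm _).map _).sum_eq, List.map_map]
      have hb : bsum (fun b => (1 : ℝ) + fat b) (Gen.merge X Y e) =
          ∑ i, bsum (fun b => (1 : ℝ) + fat b) (part st (Gen.merge X Y e) i).2 := by
        rw [sum_parts_eq st _ (fun q => bsum (fun b => (1 : ℝ) + fat b) q.2), bsum_eq_sum_clusterParts st _ (st e)]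
        rfl
      have hl : ((nonhost st X Y e).map ((fun x : Shape => (x.phi : ℝ) + ((2 * st e + 2 + 1 - x.root : ℕ) : ℝ) + 1) ∘
            fun i => toShapeR st fat (part st (Gen.merge X Y e) i).2)).sum =
          ∑ i ∈ univ.filter (fun i => i ≠ hostIdx st X Y e),
            (((toShapeR st fat (part st (Gen.merge X Y e) i).2).phi : ℝ) +
              (((2 * st e + 2 + 1 - 2 * (part st (Gen.merge X Y e) i).2.rootStep : ℕ) : ℝ) + 1)) := by
        rw [sum_nonhost]
        refine sum_congr rfl fun i _ => ?_
        simp only [Function.comp, toShapeR_root]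
        ring
      rw [hl, hb]
      have ih : ∀ i, ((toShapeR st fat (part st (Gen.merge X Y e) i).2).phi : ℝ) ≤
          bsum (fun b => (1 : ℝ) + fat b) (part st (Gen.merge X Y e) i).2 + 2 * (AG st (part st (Gen.merge X Y e) i).2 : ℝ) +
            4 * (NR st (part st (Gen.merge X Y e) i).2 : ℝ) :=
        fun i => phi_toShapeR_le (part st (Gen.merge X Y e) i).2
      have hage : ∀ i : Fin (npart st (Gen.merge X Y e)),
          (((2 * st e + 2 + 1 - 2 * (part st (Gen.merge X Y e) i).2.rootStep : ℕ) : ℝ) + 1) ≤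
            2 * ((((st e + 1 + 1 - (part st (Gen.merge X Y e) i).2.rootStep : ℕ) + 1 : ℕ) : ℝ)) := by
        intro i
        exact_mod_cast doubled_age_le (st e) (part st (Gen.merge X Y e) i).2.rootStep
      have hsplit : ∀ f : Fin (npart st (Gen.merge X Y e)) → ℝ,
          ∑ i, f i = f (hostIdx st X Y e) + ∑ i ∈ univ.filter (fun i => i ≠ hostIdx st X Y e), f i := by
        intro f
        rw [← Finset.add_sum_erase univ f (mem_univ (hostIdx st X Y e)), filter_ne']
      have hsum := sum_le_sum fun i (_ : i ∈ univ.filter (fun i => i ≠ hostIdx st X Y e)) => add_le_add (ih i) (hage i)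
      rw [hsplit (fun i => bsum (fun b => (1 : ℝ) + fat b) (part st (Gen.merge X Y e) i).2),
        hsplit (fun i => (AG st (part st (Gen.merge X Y e) i).2 : ℝ)),
        hsplit (fun i => (NR st (part st (Gen.merge X Y e) i).2 : ℝ))]
      have ihh := ih (hostIdx st X Y e)
      push_cast at hsum ⊢
      simp only [sum_add_distrib, ← mul_sum] at hsum ⊢
      linarith
termination_by G => gsize G
decreasing_by
  all_goals first
    | (simp only [gsize]; omega)
    | exact gsize_lt_of_mem_jparts st _ _ (part_mem st _ _)

/-- a one-part list has no entropy [folklore] -/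
theorem lmult_ofList_singleton (x : Shape) : (ofList [x]).lmult = 0 := by
  unfold Parts.lmult
  rw [toList_ofList]
  exact logMultinomial_eq_zero_of_card_le_one (by simp) _

/-- **THE ENTROPY OF THE RECORDED SHAPE** from the order display: `ent (toShapeR G) = E G` (the dummy parts carry no
entropy). [folklore] -/
theorem ent_toShapeR : ∀ G : Gen ε, InjPartsR st fat G → (toShapeR st fat G).ent = E st G
  | Gen.born b j, _ => by rw [toShapeR_born, E]; simp [Shape.ent]
  | Gen.renew G e h, hi => by
      rw [InjPartsR] at hi
      rw [toShapeR_renew, E, Shape.ent, lmult_ofList_singleton, Parts.entSum_eq_sum, toList_ofList, ent_toShapeR G hi]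
      simp [Shape.ent]
  | Gen.merge X Y e, hi => by
      rw [InjPartsR] at hi
      rw [toShapeR_merge, E]
      simp only [Shape.ent]
      rw [lmult_ofList_perm (sortS_perm _), lmult_eq_logMultinomial_csize_of (toShapeR st fat) hi.2,
        Parts.entSum_eq_sum, toList_ofList, ((sortS_perm _).map _).sum_eq, List.map_map]
      have hl : ((nonhost st X Y e).map (Shape.ent ∘ fun i => toShapeR st fat (part st (Gen.merge X Y e) i).2)).sum =
          ∑ i ∈ univ.filter (fun i => i ≠ hostIdx st X Y e), E st (part st (Gen.merge X Y e) i).2 := by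
        rw [sum_nonhost]
        exact sum_congr rfl fun i _ => ent_toShapeR _ (hi.1 i)
      rw [hl, ent_toShapeR _ (hi.1 _), ← Finset.add_sum_erase univ (fun i => E st (part st (Gen.merge X Y e) i).2)
        (mem_univ (hostIdx st X Y e)), filter_ne']
termination_by G => gsize G
decreasing_by
  all_goals first
    | (simp only [gsize]; omega)
    | exact gsize_lt_of_mem_jparts st _ _ (part_mem st _ _)

/-! ## §3 The ENDs paying the renewals by name -/
/-- **THE SIBLING ENTROPY OF A MEMBER IS CLASS-LINEAR PLUS `8·NR`, under `Mono` and the order display only.**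
[folklore] -/
theorem E_leR (G : Gen ε) (hm : Mono st G) (hi : InjPartsR st fat G) :
    E st G ≤ 2 * bsum (fun b => (1 : ℝ) + fat b) G + 4 * (partnerAges st G : ℝ) + 8 * (NH st G : ℝ) +
      8 * (NR st G : ℝ) := by
  have h := ent_le_two_mul_phi (toShapeR st fat G) (wf_toShapeR st fat G hm) (canon_toShapeR st fat G)
  rw [ent_toShapeR st fat G hi] at h
  have hphi := phi_toShapeR_le st fat G
  have hAG : (AG st G : ℝ) ≤ (partnerAges st G : ℝ) + 2 * (NH st G : ℝ) := by exact_mod_cast AG_le st G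
  linarith

/-- **IN THE BINDING'S LETTERS**: `Mono st G → InjPartsR st fat G →
ENT st G ≤ 2·bsum (1 + fat) G + 4·partnerAges st G + 8·mrg st G + 8·NR st G`. [folklore] -/
theorem ENT_leR (G : Gen ε) (hm : Mono st G) (hi : InjPartsR st fat G) :
    ENT st G ≤ 2 * bsum (fun b => (1 : ℝ) + fat b) G + 4 * (partnerAges st G : ℝ) + 8 * mrg st G + 8 * (NR st G : ℝ) := by
  rw [← E_eq_ENT, ← NH_cast_eq_mrg]
  exact E_leR st fat G hm hi

/-- **ON A PEDIGREE**: `HeadOldest` and `InjPartsR` alone. [folklore] -/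
theorem ENT_leR_genT {α π : Type*} [DecidableEq α] [DecidableEq π] (P : HistoryGen.Pedigree α π)
    (hH : ∀ c, P.HeadOldest c) (fatL : HistoryGen.Lab α π → ℕ) (c : α)
    (hi : InjPartsR (PEv.step ∘ Prod.fst) fatL (P.genT c)) :
    ENT (PEv.step ∘ Prod.fst) (P.genT c) ≤
      2 * bsum (fun b => (1 : ℝ) + fatL b) (P.genT c) + 4 * (partnerAges (PEv.step ∘ Prod.fst) (P.genT c) : ℝ) +
        8 * mrg (PEv.step ∘ Prod.fst) (P.genT c) + 8 * (NR (PEv.step ∘ Prod.fst) (P.genT c) : ℝ) :=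
  ENT_leR _ fatL _ (mono_genT P hH c) hi

end

end Summit.QuantumFields.BalabanUV.T4Continuum.HistorySiblingEntropyBridge
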